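import Summits.QuantumFields.YangMills.Theorems.DiagonalMirrorRPRCubeHalfRPCut
import Literature.MathematicalPhysics.QuantumFieldTheory.LatticeSiteRPMechanism

/-!
# Crux `WeakCouplingHypercubicLimitRP` (stmt-QuantumFields-27398), line `Sketch`, stub D1′ `stub_oddTorusSwapPairingLiminf`, door C
# (`cube-surgery-decoupling`, card #114): S1a — the FREE HYPERCUBE inside the scheme's own torus is EXACTLY swap-reflection-positive

Helper file (`--supports stmt-QuantumFields-27398 --as helper`) of the crux lead `lead-27398-D1` (gen 2; PICKED.md of record
`Cruxes/WeakCouplingHypercubicLimitRP/PICKED.md`: door of record B, lead's own stub work = door C's provable half); it closes nothing by itself.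
Part 4/4 of the proof (parts 1–3: `…DiagonalMirrorRPRCubeHalfRPGeometry`, `…Action`, `…Cut`).

WHAT.  `cubeHalfRP : CubeHalfRP G` (the door-C definition file `…DiagonalMirrorRPRCubeSurgeryDefs`, p828144): for every compact group `G`,
continuous unitary `ρ`, `β ≥ 0`, torus side `S`, cube half-side `R` with `2R+1 ≤ S`, and every bounded measurable real `F` depending only
on the links of the CLOSED positive half `{v = x₀ − x₁ ≥ 0} ∩ Q_R` of the free hypercube `Q_R ⊂ (ℤ/S)⁴` (plaquettes leaving `Q_R` deleted,
nothing else changed), `0 ≤ ∫ F(Θ U) F(U) dμ_{Q_R,β}` with `Θ = configPerm (0 1)` the swap `x₀ ↔ x₁`.  This is the one sub-geometry of the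
scheme's OWN lattice (same spacing, coupling, action, observables) on which diagonal swap-RP is an IDENTITY at every finite `k` — the
scheme's periodic tori are never swap-RP (`Theorems/DiagonalMirrorRPR/Negative/SquareTorusNotSwapRP`, `…/OddTorusTwist`).

PROOF (Fröhlich–Israel–Lieb–Simon reflection THROUGH SITES, one mirror layer, free far end; the tree's abstract engine
`LatticeRP.integral_mul_conj_mul_exp_nonneg_of_shared` of `Literature/…/LatticeSiteRPMechanism`, exactly as instantiated with TWO mirror layers
in `Literature/…/TiltedTorusSwapRP` and with no cut plaquettes in `Literature/…/ConstructiveQFTWave0SiteRPProofs`).  In centred representatives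
(`rep = ZMod.valMinAbs`; `2R+1 ≤ S` ⇒ nothing wraps, `rep_shift`) the cube plaquettes split by `v = x₀ − x₁` of their corners into POSITIVE
ones (all four links in the closed positive half-cube), their swap images (`mem_neg_iff_τ_mem_pos`; `Re tr ρ((Θ U)_p) = Re tr ρ(U_{τ p})`,
`re_trace_hol_configPerm_swap`, the `(0,1)`-plaquette at `θx` being traversed backwards), the SHARED `(2,3)`-plaquettes on the mirror (links of
directions `2,3` at `v = 0`, fixed by `Θ`), and the CUT `(0,1)`-plaquettes based on the mirror, whose holonomy factors as `W₊ · (W₊ ∘ Θ)⁻¹`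
with `W₊ = U(x,e₀) U(x+e₀,e₁)` in the closed positive half, so that `β Re tr ρ(U_p) = ∑ᵢ aᵢ(U) conj aᵢ(Θ U)` with
`aᵢ ∈ {√(β/2) ρ(W₊)_{ab}, √(β/2) conj ρ(W₊)_{ab}}` (`sum_a_mul_conj`, needs `β ≥ 0`); hence
`e^{−β S_{Q_R}} F(ΘU) F(U) = e^{−βN#Q_R} · g(U) conj g(ΘU) · exp(∑ᵢ aᵢ(U) conj aᵢ(ΘU))` with `g = F e^{β X_pos + β X_sh/2}` (`cube_integrand_eq`), and the
engine applies with shared block `M` = the `e₂,e₃`-links on the mirror inside the cube, positive block `P` = the other closed-half links, no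
crossing links (`Θ` fixes `M`, `configPerm_swap_apply_of_mem_M`; the swap of a positive link is not positive, `dependsOn_configPerm_swap_apply`;
`Θ` preserves product Haar measure, `measurePreserving_configPerm_swap`).  The file is definition-free: the bookkeeping objects (`d`, `τ`, `M`,
`P`, `cube`, `cut`, `sh`, `pos`, `neg`, `W₊ = cl`, `a`, `g`) are parameters constrained by their defining equations (sub-namespace `HalfRP`),
instantiated by `rfl` / `Finset.filter` in `cubeHalfRP`.

HONEST FRAMING: an exact finite-volume identity; it says nothing asymptotic.  With S1b and door C's composition
(`…PencilRigidityWeakCouplingHypercubicLimitRPOfCubeDecoupling`) it reduces D1′ to the ONE letter `AdmissibleCubeDecoupling` (torus-minus-cube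
Gram pairings → 0 in physical units), which is NOT proved anywhere for non-abelian `G` at weak coupling.  D1′, ⟨27398⟩ and its heart S6i are
OPEN; nothing here bears on the summit; the Yang–Mills mass gap is NOT proved here or anywhere in the tree.  No definition, no instance, no
notation, `autoImplicit false`.

References: J. Fröhlich, R. Israel, E. H. Lieb, B. Simon, Comm. Math. Phys. 62 (1978) 1, Thm 2.1; FILS II, J. Stat. Phys. 22 (1980) §3
(free boxes / site mirrors); K. Osterwalder, E. Seiler, Ann. Phys. 110 (1978) 440, §2; E. Seiler, LNP 159 (1982) Ch. 2.
-/

set_option autoImplicit false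

noncomputable section

open scoped SchwartzMap ComplexConjugate ComplexOrder
open MeasureTheory Filter Topology Finset Complex
open Literature.MathematicalPhysics.QuantumLattice Literature.MathematicalPhysics.AQFT
  Literature.MathematicalPhysics.QuantumFieldTheory
open Literature.Probability.LatticeModels (box)
open Summit.QuantumFields.YangMills.Cruxes.DiagonalMirrorRPR.ParityBridgeColdTraces (E4)

namespace Summit.QuantumFields.YangMills.Cruxes.DiagonalMirrorRPR.CubeSurgery

namespace HalfRP

/-! ## §3 (continued) Bookkeeping objects as constrained parameters -/

section Param

variable {G : Type} [Group G] [MeasurableSpace G] {S : ℕ} [NeZero S] {R : ℕ} (hRS : 2 * R + 1 ≤ S)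
  {d : {q : Fin 4 × Fin 4 // q.1 < q.2} → {q : Fin 4 × Fin 4 // q.1 < q.2}}
  {τ : Plaquette 4 S → Plaquette 4 S}
  {M P : Finset (Edge 4 S)} {cube cut sh pos neg : Finset (Plaquette 4 S)}

variable
  (hd : ∀ q, (d q).1 = if q.1 = ((0 : Fin 4), (1 : Fin 4)) then q.1
    else (Equiv.swap (0 : Fin 4) 1 q.1.1, Equiv.swap (0 : Fin 4) 1 q.1.2))
  (hτ : ∀ p, τ p = (sitePerm (Equiv.swap (0 : Fin 4) 1) p.1, d p.2))
  (hM : ∀ e, e ∈ M ↔ PosHalfEdge S R e ∧ (e.2 = 2 ∨ e.2 = 3) ∧ rep S e.1 0 = rep S e.1 1)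
  (hP : ∀ e, e ∈ P ↔ PosHalfEdge S R e ∧ e ∉ M)
  (hcube : ∀ p, p ∈ cube ↔ PlaqInCube S R p)
  (hcut : ∀ p, p ∈ cut ↔ PlaqInCube S R p ∧ p.2.1 = (0, 1) ∧ rep S p.1 0 = rep S p.1 1)
  (hsh : ∀ p, p ∈ sh ↔ PlaqInCube S R p ∧ p.2.1 = (2, 3) ∧ rep S p.1 0 = rep S p.1 1)
  (hpos : ∀ p, p ∈ pos ↔ PlaqInCube S R p ∧
    ((p.2.1.1 = 0 ∧ p.2.1.2 = 1 ∧ 1 ≤ rep S p.1 0 - rep S p.1 1) ∨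
      (p.2.1.1 = 0 ∧ (p.2.1.2 = 2 ∨ p.2.1.2 = 3) ∧ 0 ≤ rep S p.1 0 - rep S p.1 1) ∨
      (p.2.1.1 = 1 ∧ 1 ≤ rep S p.1 0 - rep S p.1 1) ∨ (p.2.1.1 = 2 ∧ 1 ≤ rep S p.1 0 - rep S p.1 1)))
  (hneg : neg = cube \ (cut ∪ sh ∪ pos))

/-! ### Assembly -/

section Assembly

variable {N : ℕ} (ρ : G →* Matrix (Fin N) (Fin N) ℂ)
  {cl : Plaquette 4 S → GaugeConfig 4 S G → G}
  (hcl : cl = fun p U => U (p.1, 0) * U (p.1.shift 0, 1))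
  {β : ℝ} {a : Plaquette 4 S × Fin N × Fin N × Bool → GaugeConfig 4 S G → ℂ}
  (ha : a = fun i U => if i.1 ∈ cut then (Real.sqrt (β / 2) : ℂ) *
    (if i.2.2.2 then conj (ρ (cl i.1 U) i.2.1 i.2.2.1) else ρ (cl i.1 U) i.2.1 i.2.2.1) else 0)
  {F g : GaugeConfig 4 S G → ℂ}
  (hg : g = fun U => F U * (Real.exp (β * ∑ p ∈ pos, (ρ (plaquetteHolonomy U p.1 p.2.1.1 p.2.1.2)).trace.re +
    β / 2 * ∑ p ∈ sh, (ρ (plaquetteHolonomy U p.1 p.2.1.1 p.2.1.2)).trace.re) : ℂ))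

include hd hτ hM hcube hcut hsh hpos hneg hRS hcl ha hg in
/-- **The pointwise identity**:
`conj F(Θ U) F(U) e^{−β S_{Q_R}(U)} = e^{−β N #Q_R} · g(U) conj g(Θ U) · exp(∑ᵢ aᵢ(U) conj aᵢ(Θ U))`. -/
theorem cube_integrand_eq (hu : ∀ g, ρ g ∈ Matrix.unitaryGroup (Fin N) ℂ) (hβ : 0 ≤ β) (U : GaugeConfig 4 S G) :
    conj (F (configPerm (Equiv.swap (0 : Fin 4) 1) U)) * F U * ((Real.exp (-β * cubeAction ρ S R U) : ℝ) : ℂ) =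
      ((Real.exp (-(β * ((N : ℝ) * cube.card))) : ℝ) : ℂ) *
        (g U * conj (g (configPerm (Equiv.swap (0 : Fin 4) 1) U)) *
          Complex.exp (∑ i, a i U * conj (a i (configPerm (Equiv.swap (0 : Fin 4) 1) U)))) := by
  rw [sum_a_mul_conj hcut ρ hcl ha hu hβ, ← Complex.ofReal_exp,
    cubeAction_split hd hτ hcube hcut hsh hpos hneg ρ hu U]
  subst hg
  dsimp only
  rw [sum_sh_configPerm_swap hRS hM hsh ρ U]
  simp only [map_mul, Complex.conj_ofReal]
  set XC := ∑ p ∈ cut, (ρ (plaquetteHolonomy U p.1 p.2.1.1 p.2.1.2)).trace.re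
  set XM := ∑ p ∈ sh, (ρ (plaquetteHolonomy U p.1 p.2.1.1 p.2.1.2)).trace.re
  set XP := ∑ p ∈ pos, (ρ (plaquetteHolonomy U p.1 p.2.1.1 p.2.1.2)).trace.re
  set XP' := ∑ p ∈ pos, (ρ (plaquetteHolonomy (configPerm (Equiv.swap (0 : Fin 4) 1) U) p.1 p.2.1.1 p.2.1.2)).trace.re
  rw [show -β * ((N : ℝ) * cube.card - (XC + XM + XP + XP')) =
      -(β * ((N : ℝ) * cube.card)) + ((β * XP + β / 2 * XM) + (β * XP' + β / 2 * XM) + β * XC) by ring,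
    Real.exp_add, Real.exp_add, Real.exp_add]
  push_cast
  ring

variable [TopologicalSpace G] [BorelSpace G] [IsTopologicalGroup G] [CompactSpace G]

include hd hτ hM hP hcube hcut hsh hpos hneg hRS hcl ha hg in
/-- **Swap reflection positivity of the un-normalised free-cube weight**:
`0 ≤ ∫ conj F(Θ U) F(U) e^{−β S_{Q_R}(U)} ∏ dU_e` as a complex number. -/
theorem integral_conj_mul_weight_nonneg (hρ : Continuous ρ) (hu : ∀ g, ρ g ∈ Matrix.unitaryGroup (Fin N) ℂ)
    (hβ : 0 ≤ β) (hF : Measurable F) {C : ℝ} (hFb : ∀ U, ‖F U‖ ≤ C)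
    (hFdep : DependsOn F {e : Edge 4 S | PosHalfEdge S R e}) :
    0 ≤ ∫ U, conj (F (configPerm (Equiv.swap (0 : Fin 4) 1) U)) * F U * ((Real.exp (-β * cubeAction ρ S R U) : ℝ) : ℂ)
      ∂(LatticeRP.piMeasure (haarProbability G) : Measure (GaugeConfig 4 S G)) := by
  have key := LatticeRP.integral_mul_conj_mul_exp_nonneg_of_shared (haarProbability G) M P (∅ : Finset (Edge 4 S))
    (configPerm (Equiv.swap (0 : Fin 4) 1) : GaugeConfig 4 S G → GaugeConfig 4 S G)
    measurePreserving_configPerm_swap (fun U e he => configPerm_swap_apply_of_mem_M hM U e he)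
    (fun e he => dependsOn_configPerm_swap_apply hM hP e he) (disjoint_positive_shared hP).symm
    (Finset.disjoint_empty_right _) (measurable_cubeObs ρ hg hρ hF) (fun i => measurable_a ρ hcl ha hρ i)
    (norm_g_le ρ hg hu hFb) (fun i U => norm_a_le ρ ha hu i U)
    (dependsOn_union_of_posHalf hP (dependsOn_g hRS hM hsh hpos ρ hg hFdep))
    (fun i => dependsOn_union_of_posHalf hP (dependsOn_a hRS hcut ρ hcl ha i))
  have hsplice : ∀ q : GaugeConfig 4 S G × GaugeConfig 4 S G, LatticeRP.splice (∅ : Finset (Edge 4 S)) q = q.1 :=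
    fun q => by funext i; simp [LatticeRP.splice_apply]
  simp_rw [hsplice] at key
  rw [integral_fun_fst (fun U : GaugeConfig 4 S G =>
      g U * conj (g (configPerm (Equiv.swap (0 : Fin 4) 1) U)) *
        Complex.exp (∑ i, a i U * conj (a i (configPerm (Equiv.swap (0 : Fin 4) 1) U)))), probReal_univ, one_smul] at key
  simp_rw [cube_integrand_eq hRS hd hτ hM hcube hcut hsh hpos hneg ρ hcl ha hg hu hβ]
  rw [integral_const_mul]
  exact mul_nonneg (Complex.zero_le_real.2 (Real.exp_pos _).le) key

end Assembly

end Param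

end HalfRP

/-! ## §4 The theorem: S1a `CubeHalfRP G` -/

section Main

open HalfRP

variable {G : Type} [Group G] [TopologicalSpace G] [IsTopologicalGroup G] [CompactSpace G]
  [MeasurableSpace G] [BorelSpace G]

/-- **S1a (door C, card #114): the free hypercube inside the scheme's own torus, bisected by the diagonal SITE mirror
`v = x₀ − x₁ = 0`, is EXACTLY swap-reflection-positive for `β ≥ 0`.**  For every compact group `G`, continuous unitary `ρ`,
`β ≥ 0`, torus side `S`, cube half-side `R` with `2R+1 ≤ S` and every bounded measurable real `F` depending only on the links of
the closed positive half-cube, `0 ≤ ∫ F(Θ U) F(U) dμ_{Q_R}` (`Θ = configPerm (0 1)`).  Fröhlich–Israel–Lieb–Simon site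
reflection (Comm. Math. Phys. 62 (1978) Thm 2.1) with ONE mirror layer and a free far end: shared block = the `e₂,e₃`-links on
the mirror, positive block = the other closed-half links, no crossing links, cut `(0,1)`-plaquettes on the mirror as Gram kernels;
engine `LatticeRP.integral_mul_conj_mul_exp_nonneg_of_shared`. -/
theorem cubeHalfRP : CubeHalfRP G := by
  intro N ρ hρ hu β hβ S R _ hRS F B hF hFb hFdep
  classical
  -- the bookkeeping objects
  set d : {q : Fin 4 × Fin 4 // q.1 < q.2} → {q : Fin 4 × Fin 4 // q.1 < q.2} := fun q =>
    if h : q.1 = ((0 : Fin 4), (1 : Fin 4)) then q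
    else ⟨(Equiv.swap (0 : Fin 4) 1 q.1.1, Equiv.swap (0 : Fin 4) 1 q.1.2), by
      rcases plane_cases q with h' | h' | h' | h' | h' | h'
      · exact absurd h' h
      all_goals rw [h']; decide⟩ with hd_def
  have hd : ∀ q, (d q).1 = if q.1 = ((0 : Fin 4), (1 : Fin 4)) then q.1
      else (Equiv.swap (0 : Fin 4) 1 q.1.1, Equiv.swap (0 : Fin 4) 1 q.1.2) := by
    intro q; rw [hd_def]; dsimp only; split_ifs <;> rfl
  set τ : Plaquette 4 S → Plaquette 4 S := fun p => (sitePerm (Equiv.swap (0 : Fin 4) 1) p.1, d p.2) with hτ_def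
  have hτ : ∀ p, τ p = (sitePerm (Equiv.swap (0 : Fin 4) 1) p.1, d p.2) := fun p => rfl
  set M : Finset (Edge 4 S) :=
    Finset.univ.filter fun e => PosHalfEdge S R e ∧ (e.2 = 2 ∨ e.2 = 3) ∧ rep S e.1 0 = rep S e.1 1 with hMdef
  have hM : ∀ e, e ∈ M ↔ PosHalfEdge S R e ∧ (e.2 = 2 ∨ e.2 = 3) ∧ rep S e.1 0 = rep S e.1 1 := fun e => by
    rw [hMdef, Finset.mem_filter]; simp
  set P : Finset (Edge 4 S) := Finset.univ.filter fun e => PosHalfEdge S R e ∧ e ∉ M with hPdef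
  have hP : ∀ e, e ∈ P ↔ PosHalfEdge S R e ∧ e ∉ M := fun e => by rw [hPdef, Finset.mem_filter]; simp
  set cube : Finset (Plaquette 4 S) := Finset.univ.filter fun p => PlaqInCube S R p with hcubedef
  have hcube : ∀ p, p ∈ cube ↔ PlaqInCube S R p := fun p => by rw [hcubedef, Finset.mem_filter]; simp
  set cut : Finset (Plaquette 4 S) :=
    Finset.univ.filter fun p => PlaqInCube S R p ∧ p.2.1 = (0, 1) ∧ rep S p.1 0 = rep S p.1 1 with hcutdef
  have hcut : ∀ p, p ∈ cut ↔ PlaqInCube S R p ∧ p.2.1 = (0, 1) ∧ rep S p.1 0 = rep S p.1 1 := fun p => by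
    rw [hcutdef, Finset.mem_filter]; simp
  set sh : Finset (Plaquette 4 S) :=
    Finset.univ.filter fun p => PlaqInCube S R p ∧ p.2.1 = (2, 3) ∧ rep S p.1 0 = rep S p.1 1 with hshdef
  have hsh : ∀ p, p ∈ sh ↔ PlaqInCube S R p ∧ p.2.1 = (2, 3) ∧ rep S p.1 0 = rep S p.1 1 := fun p => by
    rw [hshdef, Finset.mem_filter]; simp
  set pos : Finset (Plaquette 4 S) := Finset.univ.filter fun p => PlaqInCube S R p ∧
    ((p.2.1.1 = 0 ∧ p.2.1.2 = 1 ∧ 1 ≤ rep S p.1 0 - rep S p.1 1) ∨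
      (p.2.1.1 = 0 ∧ (p.2.1.2 = 2 ∨ p.2.1.2 = 3) ∧ 0 ≤ rep S p.1 0 - rep S p.1 1) ∨
      (p.2.1.1 = 1 ∧ 1 ≤ rep S p.1 0 - rep S p.1 1) ∨ (p.2.1.1 = 2 ∧ 1 ≤ rep S p.1 0 - rep S p.1 1)) with hposdef
  have hpos : ∀ p, p ∈ pos ↔ PlaqInCube S R p ∧
      ((p.2.1.1 = 0 ∧ p.2.1.2 = 1 ∧ 1 ≤ rep S p.1 0 - rep S p.1 1) ∨
        (p.2.1.1 = 0 ∧ (p.2.1.2 = 2 ∨ p.2.1.2 = 3) ∧ 0 ≤ rep S p.1 0 - rep S p.1 1) ∨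
        (p.2.1.1 = 1 ∧ 1 ≤ rep S p.1 0 - rep S p.1 1) ∨ (p.2.1.1 = 2 ∧ 1 ≤ rep S p.1 0 - rep S p.1 1)) := fun p => by
    rw [hposdef, Finset.mem_filter]; simp
  set cl : Plaquette 4 S → GaugeConfig 4 S G → G := fun p U => U (p.1, 0) * U (p.1.shift 0, 1) with hcl
  set a : Plaquette 4 S × Fin N × Fin N × Bool → GaugeConfig 4 S G → ℂ :=
    fun i U => if i.1 ∈ cut then (Real.sqrt (β / 2) : ℂ) *
      (if i.2.2.2 then conj (ρ (cl i.1 U) i.2.1 i.2.2.1) else ρ (cl i.1 U) i.2.1 i.2.2.1) else 0 with ha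
  set Fc : GaugeConfig 4 S G → ℂ := fun U => (F U : ℂ) with hFc
  set g : GaugeConfig 4 S G → ℂ := fun U => Fc U *
    (Real.exp (β * ∑ p ∈ pos, (ρ (plaquetteHolonomy U p.1 p.2.1.1 p.2.1.2)).trace.re +
      β / 2 * ∑ p ∈ sh, (ρ (plaquetteHolonomy U p.1 p.2.1.1 p.2.1.2)).trace.re) : ℂ) with hg
  -- the un-normalised statement, in `ℂ`
  have hFcm : Measurable Fc := Complex.measurable_ofReal.comp hF
  have hFcb : ∀ U, ‖Fc U‖ ≤ B := fun U => by rw [hFc]; dsimp only; rw [Complex.norm_real, Real.norm_eq_abs]; exact hFb U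
  have hFcdep : DependsOn Fc {e : Edge 4 S | PosHalfEdge S R e} := fun U V hUV => by
    simp only [hFc, hFdep hUV]
  have key := integral_conj_mul_weight_nonneg hRS hd hτ hM hP hcube hcut hsh hpos (neg := cube \ (cut ∪ sh ∪ pos)) rfl
    ρ hcl ha hg hρ hu hβ hFcm hFcb hFcdep
  -- the integrand is real
  have hreal : ∀ U : GaugeConfig 4 S G,
      conj (Fc (configPerm (Equiv.swap (0 : Fin 4) 1) U)) * Fc U * ((Real.exp (-β * cubeAction ρ S R U) : ℝ) : ℂ) =
        ((Real.exp (-β * cubeAction ρ S R U) * (F (configPerm (Equiv.swap (0 : Fin 4) 1) U) * F U) : ℝ) : ℂ) := by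
    intro U; simp only [hFc, Complex.conj_ofReal]; push_cast; ring
  simp_rw [hreal] at key
  rw [integral_complex_ofReal, Complex.zero_le_real] at key
  -- unfold the free-cube measure
  have hdens : Measurable fun U : GaugeConfig 4 S G => ENNReal.ofReal (Real.exp (-β * cubeAction ρ S R U)) :=
    ENNReal.measurable_ofReal.comp ((measurable_cubeAction ρ hρ).const_mul (-β)).exp
  unfold cubeMeasure
  rw [integral_smul_measure]
  unfold cubeWeight
  rw [integral_withDensity_eq_integral_toReal_smul hdens (ae_of_all _ fun _ => ENNReal.ofReal_lt_top)]
  simp_rw [ENNReal.toReal_ofReal (Real.exp_nonneg _), smul_eq_mul]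
  exact mul_nonneg ENNReal.toReal_nonneg key

end Main

end Summit.QuantumFields.YangMills.Cruxes.DiagonalMirrorRPR.CubeSurgery

end
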